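import Literature.ModelTheory.ExponentialFields.SemialgebraicStrongRichCut
import HarnessLib

/-!
# The dichotomy refinement (Pawłucki's Lemma 5.1, first step)

Topic `Literature/ModelTheory/ExponentialFields` — block B2d of the proof of the
`C¹`-triangulation theorem for compact semialgebraic sets
(`Literature.ModelTheory.ExponentialFields.OhmotoShiota2017_c1Triangulation`, statement of
[OhmotoShiota2017, Thm. 1.1]) along the proof of [Pawlucki2024], specialized to `p = 1`.

**The first step of the proof of [Pawlucki2024, Lemma 5.1]**: given a laminar family `α` over a
compact semialgebraic `D`, a map `f` continuous on its total capsule and, on the open pieces of a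
subfamily `𝒦₁`, `C¹` in `t` with continuous semialgebraic derivative `g = ∂f/∂t`, the open pieces
of `𝒦₁` are covered by the open sets `U₀ = {|g_ν| < C ∀ν}` and
`V_μ = {|g_μ| > C⁻¹, |g_ν| < 2|g_μ| ∀ν}` ((5.1.7)–(5.1.9)); by [Pawlucki2024, Prop. 2.5] in the strong
laminar form (block B2d₃) each piece of `𝒦₁` is refined into a laminar family every piece of which
has, for its INDEX, one member of the cover containing all its nonempty open fibres.  Concatenating
over the pieces gives the case data `CRDerivHyp` of block B5 (`exists_crDerivHyp`).

The cover sets are made open in `ℝᵐ⁺¹` (as Prop. 2.5 requires) by the device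
`V'_j = ℝᵐ⁺¹ ∖ cl (P ∖ cond_j)` for the fibrewise-open piece `P` (relatively open conditions).

No named facts are introduced (D-0026).

## References

* [Pawlucki2024] W. Pawłucki, *Strict `C^p`-triangulations — a new approach to
  desingularization*, J. Eur. Math. Soc. 26 (2024), 3863–3909, Lemma 5.1 (proof, (5.1.7)–(5.1.9)),
  Prop. 2.5.
* [OhmotoShiota2017] T. Ohmoto, M. Shiota, *`C¹`-triangulations of semialgebraic sets*,
  J. Topology 10 (2017), Thm. 1.1 (statement only).
-/

noncomputable section

open Set Filter Metric
open _root_.Topology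

namespace Literature.ModelTheory.ExponentialFields

open Literature.NumberTheory.Transcendental (IsSemialgebraicFunOn IsSemialgebraicMapOn
  isSemialgebraicFunOn_iff)
open Literature.NumberTheory.Transcendental.SemialgebraicMonotonicity (sa_lt sa_le)

section Dichotomy

variable {m d : ℕ}

/-! ### The open piece in `snoc` coordinates and the dichotomy conditions -/

/-- The fibrewise-open piece `P_i = {(x, t) : x ∈ D, α_i x < t < α_{i+1} x}` in `ℝᵐ⁺¹`.
[cite: Pawlucki2024, Lemma 5.1] -/
def hatP (D : Set (Fin m → ℝ)) (α : ℕ → (Fin m → ℝ) → ℝ) (i : ℕ) : Set (Fin (m + 1) → ℝ) :=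
  {z | Fin.init z ∈ D ∧ α i (Fin.init z) < z (Fin.last m) ∧ z (Fin.last m) < α (i + 1) (Fin.init z)}

/-- `snoc x t ∈ P_i ↔ x ∈ D ∧ t ∈ (α_i x, α_{i+1} x)`. [cite: Pawlucki2024, Lemma 5.1] -/
@[simp] theorem snoc_mem_hatP {D : Set (Fin m → ℝ)} {α : ℕ → (Fin m → ℝ) → ℝ} {i : ℕ} {x : Fin m → ℝ} {t : ℝ} :
    (Fin.snoc x t : Fin (m + 1) → ℝ) ∈ hatP D α i ↔ x ∈ D ∧ α i x < t ∧ t < α (i + 1) x := by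
  simp [hatP]

/-- The derivative in `snoc` coordinates. [cite: Pawlucki2024, Lemma 5.1] -/
def hatG (g : Fin d → (Fin m → ℝ) → ℝ → ℝ) (ν : Fin d) (z : Fin (m + 1) → ℝ) : ℝ := g ν (Fin.init z) (z (Fin.last m))

/-- `hatG` on `snoc x t`. [cite: Pawlucki2024, Lemma 5.1] -/
@[simp] theorem hatG_snoc (g : Fin d → (Fin m → ℝ) → ℝ → ℝ) (ν : Fin d) (x : Fin m → ℝ) (t : ℝ) :
    hatG g ν (Fin.snoc x t) = g ν x t := by simp [hatG]

/-- The dichotomy conditions: `j = 0`: all `|g_ν| < C` (5.1.7); `j = μ + 1`: `|g_μ| > C⁻¹` and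
`|g_ν| < 2|g_μ|` for all `ν` ((5.1.8)–(5.1.9) with room). [cite: Pawlucki2024, Lemma 5.1, (5.1.7)–(5.1.9)] -/
def dCond (g : Fin d → (Fin m → ℝ) → ℝ → ℝ) (C : ℝ) (j : Fin (d + 1)) (z : Fin (m + 1) → ℝ) : Prop :=
  Fin.cases (∀ ν, |hatG g ν z| < C) (fun μ => C⁻¹ < |hatG g μ z| ∧ ∀ ν, |hatG g ν z| < 2 * |hatG g μ z|) j

/-- `dCond` at `j = 0`. [cite: Pawlucki2024, (5.1.7)] -/
@[simp] theorem dCond_zero {g : Fin d → (Fin m → ℝ) → ℝ → ℝ} {C : ℝ} {z : Fin (m + 1) → ℝ} :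
    dCond g C 0 z ↔ ∀ ν, |hatG g ν z| < C := by simp [dCond]

/-- `dCond` at `j = μ + 1`. [cite: Pawlucki2024, (5.1.8)–(5.1.9)] -/
@[simp] theorem dCond_succ {g : Fin d → (Fin m → ℝ) → ℝ → ℝ} {C : ℝ} {μ : Fin d} {z : Fin (m + 1) → ℝ} :
    dCond g C μ.succ z ↔ C⁻¹ < |hatG g μ z| ∧ ∀ ν, |hatG g ν z| < 2 * |hatG g μ z| := by simp [dCond]

/-- **The dichotomy**: every point satisfies one of the conditions, when `C > 1`.
[cite: Pawlucki2024, Lemma 5.1, "If C is sufficiently large … one of the following two cases holds"] -/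
theorem exists_dCond (g : Fin d → (Fin m → ℝ) → ℝ → ℝ) {C : ℝ} (hC : 1 < C) (z : Fin (m + 1) → ℝ) :
    ∃ j, dCond g C j z := by
  classical
  by_cases h0 : ∀ ν, |hatG g ν z| < C
  · exact ⟨0, dCond_zero.2 h0⟩
  · push Not at h0
    obtain ⟨ν₀, hν₀⟩ := h0
    -- the index of a maximal `|g_ν|`
    obtain ⟨μ, -, hμ⟩ := Finset.exists_max_image Finset.univ (fun ν => |hatG g ν z|) ⟨ν₀, Finset.mem_univ _⟩
    have hMpos : C ≤ |hatG g μ z| := hν₀.trans (hμ ν₀ (Finset.mem_univ _))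
    have hC0 : 0 < C := one_pos.trans hC
    refine ⟨μ.succ, dCond_succ.2 ⟨?_, fun ν => ?_⟩⟩
    · have : C⁻¹ < 1 := inv_lt_one_of_one_lt₀ hC
      linarith
    · have h := hμ ν (Finset.mem_univ _)
      have hpos : 0 < |hatG g μ z| := hC0.trans_le hMpos
      linarith

/-- The cover sets `V'_j = ℝᵐ⁺¹ ∖ cl (P ∖ cond_j)` (open by construction).
[cite: Pawlucki2024, Lemma 5.1 with Prop. 2.5] -/
def dCover (D : Set (Fin m → ℝ)) (α : ℕ → (Fin m → ℝ) → ℝ) (i : ℕ) (g : Fin d → (Fin m → ℝ) → ℝ → ℝ) (C : ℝ)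
    (j : Fin (d + 1)) : Set (Fin (m + 1) → ℝ) :=
  (closure (hatP D α i ∩ {z | ¬ dCond g C j z}))ᶜ

/-- The cover sets are open. [cite: Pawlucki2024, Prop. 2.5] -/
theorem isOpen_dCover (D : Set (Fin m → ℝ)) (α : ℕ → (Fin m → ℝ) → ℝ) (i : ℕ) (g : Fin d → (Fin m → ℝ) → ℝ → ℝ)
    (C : ℝ) (j : Fin (d + 1)) : IsOpen (dCover D α i g C j) :=
  isClosed_closure.isOpen_compl

/-- On the piece, membership in `V'_j` gives the condition. [cite: Pawlucki2024, Lemma 5.1] -/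
theorem dCond_of_mem_dCover {D : Set (Fin m → ℝ)} {α : ℕ → (Fin m → ℝ) → ℝ} {i : ℕ}
    {g : Fin d → (Fin m → ℝ) → ℝ → ℝ} {C : ℝ} {j : Fin (d + 1)} {z : Fin (m + 1) → ℝ} (hz : z ∈ hatP D α i)
    (hV : z ∈ dCover D α i g C j) : dCond g C j z := by
  by_contra h
  exact hV (subset_closure ⟨hz, h⟩)

variable {D : Set (Fin m → ℝ)} {α : ℕ → (Fin m → ℝ) → ℝ} {i : ℕ} {g : Fin d → (Fin m → ℝ) → ℝ → ℝ} {C : ℝ}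

/-- `hatG` is continuous on the piece when `g` is continuous on the open piece. [cite: Pawlucki2024, Lemma 5.1] -/
theorem continuousOn_hatG (hg : ∀ ν, ContinuousOn (fun p : (Fin m → ℝ) × ℝ => g ν p.1 p.2) (lamOpenPiece D α i)) (ν : Fin d) :
    ContinuousOn (hatG g ν) (hatP D α i) := by
  have hmap : MapsTo (fun z : Fin (m + 1) → ℝ => (Fin.init z, z (Fin.last m))) (hatP D α i) (lamOpenPiece D α i) :=
    fun z hz => hz
  have hc : Continuous fun z : Fin (m + 1) → ℝ => (Fin.init z, z (Fin.last m)) :=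
    (continuous_pi fun i => continuous_apply _).prodMk (continuous_apply _)
  exact (hg ν).comp hc.continuousOn hmap

/-- The conditions are relatively open on the piece: a point of the piece satisfying `cond_j` lies in
`V'_j`. [cite: Pawlucki2024, Lemma 5.1] -/
theorem mem_dCover_of_dCond (hg : ∀ ν, ContinuousOn (fun p : (Fin m → ℝ) × ℝ => g ν p.1 p.2) (lamOpenPiece D α i))
    {j : Fin (d + 1)} {z : Fin (m + 1) → ℝ} (hz : z ∈ hatP D α i) (hc : dCond g C j z) : z ∈ dCover D α i g C j := by
  -- an open neighbourhood of `z` on which (inside the piece) the condition holds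
  have hev : ∀ᶠ w in 𝓝[hatP D α i] z, dCond g C j w := by
    have hG : ∀ ν, Tendsto (hatG g ν) (𝓝[hatP D α i] z) (𝓝 (hatG g ν z)) := fun ν => continuousOn_hatG hg ν z hz
    revert hc
    refine Fin.cases ?_ (fun μ => ?_) j
    · intro hc
      rw [dCond_zero] at hc
      have h : ∀ ν, ∀ᶠ w in 𝓝[hatP D α i] z, |hatG g ν w| < C := fun ν =>
        ((continuous_abs.tendsto _).comp (hG ν)).eventually (Iio_mem_nhds (hc ν))
      have h' := Filter.eventually_all.2 h
      filter_upwards [h'] with w hw using dCond_zero.2 hw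
    · intro hc
      rw [dCond_succ] at hc
      have h1 : ∀ᶠ w in 𝓝[hatP D α i] z, C⁻¹ < |hatG g μ w| :=
        ((continuous_abs.tendsto _).comp (hG μ)).eventually (Ioi_mem_nhds hc.1)
      have h2 : ∀ ν, ∀ᶠ w in 𝓝[hatP D α i] z, |hatG g ν w| < 2 * |hatG g μ w| := fun ν => by
        have ht : Tendsto (fun w => 2 * |hatG g μ w| - |hatG g ν w|) (𝓝[hatP D α i] z)
            (𝓝 (2 * |hatG g μ z| - |hatG g ν z|)) :=
          ((((continuous_abs.tendsto _).comp (hG μ)).const_mul 2).sub ((continuous_abs.tendsto _).comp (hG ν)))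
        have hpos : 0 < 2 * |hatG g μ z| - |hatG g ν z| := by linarith [hc.2 ν]
        filter_upwards [ht.eventually (Ioi_mem_nhds hpos)] with w hw
        have hw' : 0 < 2 * |hatG g μ w| - |hatG g ν w| := hw
        linarith
      have h2' := Filter.eventually_all.2 h2
      filter_upwards [h1, h2'] with w hw1 hw2 using dCond_succ.2 ⟨hw1, hw2⟩
  obtain ⟨U, hU, hzU, hsub⟩ := mem_nhdsWithin.1 hev
  -- `U` misses `P ∖ cond_j`, hence `z ∉ closure (P ∖ cond_j)`
  intro hzcl
  have hne := mem_closure_iff_nhds.1 hzcl U (hU.mem_nhds hzU)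
  obtain ⟨w, hwU, hwP, hwc⟩ := hne
  exact hwc (hsub ⟨hwU, hwP⟩)

/-- **The cover**: the open fibres of the piece are covered by the `V'_j` (`C > 1`).
[cite: Pawlucki2024, Lemma 5.1] -/
theorem exists_mem_dCover (hg : ∀ ν, ContinuousOn (fun p : (Fin m → ℝ) × ℝ => g ν p.1 p.2) (lamOpenPiece D α i))
    (hC : 1 < C) {x : Fin m → ℝ} (hx : x ∈ D) {t : ℝ} (ht : t ∈ Ioo (α i x) (α (i + 1) x)) :
    ∃ j, (Fin.snoc x t : Fin (m + 1) → ℝ) ∈ dCover D α i g C j := by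
  obtain ⟨j, hj⟩ := exists_dCond g hC (Fin.snoc x t)
  exact ⟨j, mem_dCover_of_dCond hg (snoc_mem_hatP.2 ⟨hx, ht.1, ht.2⟩) hj⟩

/-! #### Semialgebraicity of the cover -/

/-- The piece is semialgebraic. [cite: Pawlucki2024, Lemma 5.1] -/
theorem isSemialgebraic_hatP (hα : ∀ k, IsSemialgebraicFunOn ℝ D (α k)) (i : ℕ) :
    IsSemialgebraic ℝ (hatP D α i) := by
  have h1 : IsSemialgebraic ℝ {z : Fin (m + 1) → ℝ | Fin.init z ∈ D ∧ α i (Fin.init z) < z (Fin.last m)} := by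
    have h := (hα i).isSemialgebraic_setOf_snoc_mem tarski_seidenberg_real_holds
      (T := {u : Fin (m + 2) → ℝ | u (Fin.last (m + 1)) < u (Fin.castSucc (Fin.last m))}) (sa_lt _ _)
    convert h using 1
    ext z; simp
  have h2 : IsSemialgebraic ℝ {z : Fin (m + 1) → ℝ | Fin.init z ∈ D ∧ z (Fin.last m) < α (i + 1) (Fin.init z)} := by
    have h := (hα (i + 1)).isSemialgebraic_setOf_snoc_mem tarski_seidenberg_real_holds
      (T := {u : Fin (m + 2) → ℝ | u (Fin.castSucc (Fin.last m)) < u (Fin.last (m + 1))}) (sa_lt _ _)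
    convert h using 1
    ext z; simp
  convert h1.inter h2 using 1
  ext z
  simp only [hatP, mem_setOf_eq, mem_inter_iff]
  tauto

/-- Sub-level sets of a semialgebraic function on a semialgebraic set (strict). [cite: BochnakCosteRoy1998, §2.2] -/
theorem sa_sep_lt_fun {n : ℕ} {O : Set (Fin n → ℝ)} {f h : (Fin n → ℝ) → ℝ} (hf : IsSemialgebraicFunOn ℝ O f)
    (hh : IsSemialgebraicFunOn ℝ O h) : IsSemialgebraic ℝ {x | x ∈ O ∧ f x < h x} :=
  LensFamilies.sa_sep_lt' hf hh

/-- The condition sets on the piece are semialgebraic. [cite: Pawlucki2024, Lemma 5.1] -/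
theorem isSemialgebraic_hatP_dCond (hP : IsSemialgebraic ℝ (hatP D α i))
    (hgs : ∀ ν, IsSemialgebraicFunOn ℝ (hatP D α i) (hatG g ν)) (C : ℝ) (j : Fin (d + 1)) :
    IsSemialgebraic ℝ (hatP D α i ∩ {z | dCond g C j z}) := by
  classical
  have habs : ∀ ν, IsSemialgebraicFunOn ℝ (hatP D α i) (fun z => |hatG g ν z|) := fun ν => (hgs ν).abs
  have hconst : ∀ c : ℝ, IsSemialgebraicFunOn ℝ (hatP D α i) (fun _ => c) := fun c => isSemialgebraicFunOn_const' hP c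
  refine Fin.cases ?_ (fun μ => ?_) j
  · have h : hatP D α i ∩ {z | dCond g C 0 z} =
        hatP D α i ∩ ⋂ ν ∈ (Finset.univ : Finset (Fin d)), {z | z ∈ hatP D α i ∧ |hatG g ν z| < C} := by
      ext z
      simp only [mem_inter_iff, mem_setOf_eq, dCond_zero, mem_iInter, Finset.mem_univ, forall_true_left]
      exact ⟨fun ⟨hz, h⟩ => ⟨hz, fun ν => ⟨hz, h ν⟩⟩, fun ⟨hz, h⟩ => ⟨hz, fun ν => (h ν).2⟩⟩
    rw [h]
    exact hP.inter (IsSemialgebraic.biInter _ _ fun ν _ => sa_sep_lt_fun (habs ν) (hconst C))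
  · have h2μ : IsSemialgebraicFunOn ℝ (hatP D α i) (fun z => 2 * |hatG g μ z|) :=
      IsSemialgebraicFunOn.mul_holds (hconst 2) (habs μ)
    have h : hatP D α i ∩ {z | dCond g C μ.succ z} =
        {z | z ∈ hatP D α i ∧ C⁻¹ < |hatG g μ z|} ∩
          ⋂ ν ∈ (Finset.univ : Finset (Fin d)), {z | z ∈ hatP D α i ∧ |hatG g ν z| < 2 * |hatG g μ z|} := by
      ext z
      simp only [mem_inter_iff, mem_setOf_eq, dCond_succ, mem_iInter, Finset.mem_univ, forall_true_left]
      constructor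
      · rintro ⟨hz, h1, h2⟩; exact ⟨⟨hz, h1⟩, fun ν => ⟨hz, h2 ν⟩⟩
      · rintro ⟨⟨hz, h1⟩, h2⟩
        refine ⟨hz, h1, fun ν => (h2 ν).2⟩
    rw [h]
    exact (sa_sep_lt_fun (hconst C⁻¹) (habs μ)).inter
      (IsSemialgebraic.biInter _ _ fun ν _ => sa_sep_lt_fun (habs ν) h2μ)

/-- **The cover sets are semialgebraic.** [cite: Pawlucki2024, Lemma 5.1 with Prop. 2.5] -/
theorem isSemialgebraic_dCover (hP : IsSemialgebraic ℝ (hatP D α i))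
    (hgs : ∀ ν, IsSemialgebraicFunOn ℝ (hatP D α i) (hatG g ν)) (C : ℝ) (j : Fin (d + 1)) :
    IsSemialgebraic ℝ (dCover D α i g C j) := by
  unfold dCover
  have h : hatP D α i ∩ {z | ¬ dCond g C j z} = hatP D α i \ (hatP D α i ∩ {z | dCond g C j z}) := by
    ext z; simp only [mem_inter_iff, mem_setOf_eq, Set.mem_sdiff, not_and]; tauto
  rw [h]
  exact (isSemialgebraic_closure (hP.diff (isSemialgebraic_hatP_dCond hP hgs C j))).compl

/-! ### Refinement of one piece -/

/-- **Refinement of one `𝒦₁`-piece** by the strong rich cut lemma applied to the dichotomy cover.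
[cite: Pawlucki2024, Lemma 5.1 (proof, first paragraph), Prop. 2.5] -/
theorem exists_piece_refinement (hDc : IsCompact D) (hDs : IsSemialgebraic ℝ D)
    (hαc : ∀ k, ContinuousOn (α k) D) (hαs : ∀ k, IsSemialgebraicFunOn ℝ D (α k)) (hαm : ∀ x ∈ D, Monotone fun k => α k x)
    (i : ℕ) (hg : ∀ ν, ContinuousOn (fun p : (Fin m → ℝ) × ℝ => g ν p.1 p.2) (lamOpenPiece D α i))
    (hgs : ∀ ν, IsSemialgebraicFunOn ℝ (hatP D α i) (hatG g ν)) (hC : 1 < C) :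
    ∃ (R : ℕ) (β : ℕ → (Fin m → ℝ) → ℝ) (jw : ℕ → Fin (d + 1)),
      (∀ n, ContinuousOn (β n) D) ∧ (∀ n, IsSemialgebraicFunOn ℝ D (β n)) ∧
      (∀ x ∈ D, Monotone fun n => β n x) ∧ (∀ x ∈ D, β 0 x = α i x) ∧ (∀ x ∈ D, ∀ n, R ≤ n → β n x = α (i + 1) x) ∧
      ∀ n, ∀ x ∈ D, β n x < β (n + 1) x →
        ∀ t ∈ Ioo (β n x) (β (n + 1) x), dCond g C (jw n) (Fin.snoc x t) := by
  obtain ⟨a, hac, has, haeq⟩ := exists_continuous_semialgebraic_extension hDc hDs (hαs i) (hαc i)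
  obtain ⟨b, hbc, hbs, hbeq⟩ := exists_continuous_semialgebraic_extension hDc hDs (hαs (i + 1)) (hαc (i + 1))
  have hab : ∀ x ∈ D, a x ≤ b x := fun x hx => by rw [haeq hx, hbeq hx]; exact hαm x hx (Nat.le_succ i)
  have hP := isSemialgebraic_hatP hαs i (D := D)
  obtain ⟨R, β, jw, h1, h2, h3, h4, h5, h6⟩ := exists_indexed_laminar_refinement hDc hDs hac hbc has hbs hab
    (Nat.succ_pos d) (fun j => isOpen_dCover D α i g C j) (fun j => isSemialgebraic_dCover hP hgs C j)
    (fun x hx t ht => exists_mem_dCover hg hC hx (by rw [haeq hx, hbeq hx] at ht; exact ht))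
  refine ⟨R, β, jw, h1, h2, h3, fun x hx => by rw [h4 x hx, haeq hx], fun x hx n hn => by rw [h5 x hx n hn, hbeq hx],
    fun n x hx hlt t ht => ?_⟩
  have hmem := h6 n x hx hlt t ht
  -- the point lies in the piece
  have hlo : α i x ≤ β n x := by rw [← haeq hx, ← h4 x hx]; exact h3 x hx (Nat.zero_le n)
  have hhi : β (n + 1) x ≤ α (i + 1) x := by
    rw [← hbeq hx, ← h5 x hx (max R (n + 1)) (le_max_left _ _)]; exact h3 x hx (le_max_right _ _)
  exact dCond_of_mem_dCover (snoc_mem_hatP.2 ⟨hx, hlo.trans_lt ht.1, ht.2.trans_le hhi⟩) hmem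

/-! ### Concatenation over the pieces and the case data of Lemma 5.1 -/

/-- Case flag from a cover index: `0 ↦ Case I`, `μ+1 ↦ Case II`. [cite: Pawlucki2024, Lemma 5.1] -/
def caseOfIdx (j : Fin (d + 1)) : Bool := Fin.cases false (fun _ => true) j

/-- Dominating coordinate from a cover index (`μ₀` by default). [cite: Pawlucki2024, Lemma 5.1] -/
def muOfIdx (μ₀ : Fin d) (j : Fin (d + 1)) : Fin d := Fin.cases μ₀ (fun μ => μ) j

/-- `caseOfIdx 0 = false`. [cite: Pawlucki2024, Lemma 5.1] -/
@[simp] theorem caseOfIdx_zero : caseOfIdx (0 : Fin (d + 1)) = false := rfl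

/-- `caseOfIdx μ.succ = true`. [cite: Pawlucki2024, Lemma 5.1] -/
@[simp] theorem caseOfIdx_succ (μ : Fin d) : caseOfIdx μ.succ = true := by simp [caseOfIdx]

/-- `muOfIdx μ₀ μ.succ = μ`. [cite: Pawlucki2024, Lemma 5.1] -/
@[simp] theorem muOfIdx_succ (μ₀ μ : Fin d) : muOfIdx μ₀ μ.succ = μ := by simp [muOfIdx]

/-- If `caseOfIdx j = true` then `j = (muOfIdx μ₀ j).succ`. [cite: Pawlucki2024, Lemma 5.1] -/
theorem eq_succ_of_caseOfIdx {μ₀ : Fin d} {j : Fin (d + 1)} (h : caseOfIdx j = true) : j = (muOfIdx μ₀ j).succ := by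
  revert h
  refine Fin.cases ?_ (fun μ => ?_) j
  · simp
  · intro; simp

/-- If `caseOfIdx j = false` then `j = 0`. [cite: Pawlucki2024, Lemma 5.1] -/
theorem eq_zero_of_caseOfIdx {j : Fin (d + 1)} (h : caseOfIdx j = false) : j = 0 := by
  revert h
  refine Fin.cases ?_ (fun μ => ?_) j
  · simp
  · simp

/-- **The dichotomy refinement** [Pawlucki2024, Lemma 5.1, first step of the proof]: the laminar
family refined on its `𝒦₁`-pieces so that every refined `𝒦₁`-piece is of Case I or of Case II for
its index, packaged as the case data `CRDerivHyp` of the fibre-smoothing construction (block B5),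
with constant `c = 2`. [cite: Pawlucki2024, Lemma 5.1 (proof), (5.1.7)–(5.1.9), Prop. 2.5] -/
theorem exists_crDerivHyp (hd : 0 < d) (hDc : IsCompact D) (hDs : IsSemialgebraic ℝ D)
    (hαc : ∀ k, ContinuousOn (α k) D) (hαs : ∀ k, IsSemialgebraicFunOn ℝ D (α k)) (hαm : ∀ x ∈ D, Monotone fun k => α k x)
    (r₀ : ℕ) {f : (Fin m → ℝ) → ℝ → Fin d → ℝ} (hf : ContinuousOn (fun p : (Fin m → ℝ) × ℝ => f p.1 p.2) (lamTotal D α r₀))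
    {K1 : Set ℕ}
    (hderiv : ∀ i ∈ K1, i < r₀ → ∀ x ∈ D, ∀ t ∈ Ioo (α i x) (α (i + 1) x), ∀ ν, HasDerivAt (fun t => f x t ν) (g ν x t) t)
    (hg : ∀ i ∈ K1, i < r₀ → ∀ ν, ContinuousOn (fun p : (Fin m → ℝ) × ℝ => g ν p.1 p.2) (lamOpenPiece D α i))
    (hgs : ∀ i ∈ K1, i < r₀ → ∀ ν, IsSemialgebraicFunOn ℝ (hatP D α i) (hatG g ν)) :
    ∃ (r : ℕ) (β : ℕ → (Fin m → ℝ) → ℝ) (orig : ℕ → ℕ) (caseII : ℕ → Bool) (μ : ℕ → Fin d),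
      (∀ n, IsSemialgebraicFunOn ℝ D (β n)) ∧ (∀ x ∈ D, β 0 x = α 0 x) ∧ (∀ x ∈ D, ∀ n, r ≤ n → β n x = α r₀ x) ∧
      (∀ n < r, orig n < r₀) ∧ (∀ n, ∀ x ∈ D, α (orig n) x ≤ β n x ∧ β (n + 1) x ≤ α (orig n + 1) x) ∧
      CRDerivHyp D β r f caseII μ g {n | n < r ∧ orig n ∈ K1} 2 := by
  classical
  set μ₀ : Fin d := ⟨0, hd⟩ with hμ₀
  -- per-piece refinements (trivial off `𝒦₁`)
  have hpiece : ∀ i, ∃ (R : ℕ) (β : ℕ → (Fin m → ℝ) → ℝ) (jw : ℕ → Fin (d + 1)),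
      (∀ n, ContinuousOn (β n) D) ∧ (∀ n, IsSemialgebraicFunOn ℝ D (β n)) ∧
      (∀ x ∈ D, Monotone fun n => β n x) ∧ (∀ x ∈ D, β 0 x = α i x) ∧ (∀ x ∈ D, ∀ n, R ≤ n → β n x = α (i + 1) x) ∧
      ((i ∈ K1 ∧ i < r₀) → ∀ n, ∀ x ∈ D, β n x < β (n + 1) x →
        ∀ t ∈ Ioo (β n x) (β (n + 1) x), dCond g 2 (jw n) (Fin.snoc x t)) := by
    intro i
    by_cases hi : i ∈ K1 ∧ i < r₀
    · obtain ⟨R, β, jw, h1, h2, h3, h4, h5, h6⟩ := exists_piece_refinement hDc hDs hαc hαs hαm i (hg i hi.1 hi.2)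
        (hgs i hi.1 hi.2) (C := 2) (by norm_num)
      exact ⟨R, β, jw, h1, h2, h3, h4, h5, fun _ => h6⟩
    · refine ⟨1, fun n => if n = 0 then α i else α (i + 1), fun _ => 0, fun n => ?_, fun n => ?_, fun x hx => ?_,
        fun x hx => by simp, fun x hx n hn => by simp [show n ≠ 0 by omega], fun h => absurd h hi⟩
      · show ContinuousOn (if n = 0 then α i else α (i + 1)) D
        split_ifs
        · exact hαc i
        · exact hαc (i + 1)
      · show IsSemialgebraicFunOn ℝ D (if n = 0 then α i else α (i + 1))
        split_ifs
        · exact hαs i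
        · exact hαs (i + 1)
      · intro n n' hnn'
        by_cases hn : n = 0
        · subst hn
          by_cases hn' : n' = 0
          · subst hn'; exact le_rfl
          · simp only [if_true, if_neg hn']; exact hαm x hx (Nat.le_succ i)
        · have hn' : n' ≠ 0 := by omega
          simp only [if_neg hn, if_neg hn']; exact le_rfl
  choose Rp βp jwp hβc hβs hβm hβ0 hβR hgood using hpiece
  -- uniform block length
  set R : ℕ := 1 + ∑ i ∈ Finset.range r₀, Rp i with hR
  have hRpos : 0 < R := by rw [hR]; omega
  have hRle : ∀ i < r₀, Rp i ≤ R := fun i hi => by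
    rw [hR]
    have := Finset.single_le_sum (f := Rp) (fun i _ => Nat.zero_le _) (Finset.mem_range.2 hi)
    omega
  -- the concatenated family
  set β : ℕ → (Fin m → ℝ) → ℝ := fun n => if n / R < r₀ then βp (n / R) (n % R) else α r₀ with hβ
  set orig : ℕ → ℕ := fun n => if n / R < r₀ then n / R else r₀ - 1 with horig
  set jw : ℕ → Fin (d + 1) := fun n => if n / R < r₀ ∧ n / R ∈ K1 then jwp (n / R) (n % R) else 0 with hjw
  set r := R * r₀ with hr
  -- block values at the ends
  have hβp_top : ∀ i < r₀, ∀ x ∈ D, ∀ n, Rp i ≤ n → βp i n x = α (i + 1) x := fun i _ x hx n hn => hβR i x hx n hn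
  have hβp_mem : ∀ i < r₀, ∀ x ∈ D, ∀ n, βp i n x ∈ Icc (α i x) (α (i + 1) x) := fun i hi x hx n =>
    ⟨by rw [← hβ0 i x hx]; exact hβm i x hx (Nat.zero_le n),
     by rw [← hβp_top i hi x hx (max (Rp i) n) (le_max_left _ _)]; exact hβm i x hx (le_max_right _ _)⟩
  -- div/mod bookkeeping
  have hdiv_lt : ∀ n, n / R < r₀ ↔ n < r := fun n => by rw [hr, Nat.div_lt_iff_lt_mul hRpos, mul_comm]
  have hβ_of_lt : ∀ n, n < r → β n = βp (n / R) (n % R) := fun n hn => by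
    simp only [hβ]; rw [if_pos ((hdiv_lt n).2 hn)]
  have hβ_of_ge : ∀ n, r ≤ n → β n = α r₀ := fun n hn => by
    simp only [hβ]; rw [if_neg (by rw [hdiv_lt]; omega)]
  -- the successor inside and across blocks
  have hsucc : ∀ n, n < r → ∀ x ∈ D, β (n + 1) x = βp (n / R) (n % R + 1) x := by
    intro n hn x hx
    have hk : n / R < r₀ := (hdiv_lt n).2 hn
    set k := n / R
    set j := n % R
    have hnkj : n = R * k + j := (Nat.div_add_mod n R).symm
    have hj : j < R := Nat.mod_lt n hRpos
    by_cases hj1 : j + 1 < R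
    · have e : n + 1 = R * k + (j + 1) := by omega
      have hlt : n + 1 < r := by
        rw [hr]; calc n + 1 = R * k + (j + 1) := e
          _ < R * k + R := by omega
          _ = R * (k + 1) := by ring
          _ ≤ R * r₀ := Nat.mul_le_mul_left _ hk
      rw [hβ_of_lt (n + 1) hlt]
      show βp ((n + 1) / R) ((n + 1) % R) x = βp k (j + 1) x
      rw [e, Nat.mul_add_div hRpos, Nat.mul_add_mod, Nat.div_eq_of_lt hj1, Nat.mod_eq_of_lt hj1, add_zero]
    · have hjR : j + 1 = R := by omega
      have e : n + 1 = R * (k + 1) + 0 := by rw [mul_add, mul_one, add_zero]; omega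
      -- value of the right-hand side: top of block `k`
      have hrhs : βp k (j + 1) x = α (k + 1) x := hβp_top k hk x hx (j + 1) (by rw [hjR]; exact hRle k hk)
      rw [hrhs]
      by_cases hk1 : k + 1 < r₀
      · have hlt : n + 1 < r := by rw [hr, e, add_zero]; exact Nat.mul_lt_mul_of_pos_left hk1 hRpos
        rw [hβ_of_lt (n + 1) hlt]
        show βp ((n + 1) / R) ((n + 1) % R) x = α (k + 1) x
        rw [e, Nat.mul_add_div hRpos, Nat.mul_add_mod, Nat.zero_div, Nat.zero_mod, add_zero, hβ0 (k + 1) x hx]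
      · have hk1' : k + 1 = r₀ := by omega
        have hge : r ≤ n + 1 := by rw [hr, e, add_zero, hk1']
        rw [hβ_of_ge (n + 1) hge, ← hk1']
  -- containment in the original pieces
  have hcontain : ∀ n, ∀ x ∈ D, α (orig n) x ≤ β n x ∧ β (n + 1) x ≤ α (orig n + 1) x := by
    intro n x hx
    by_cases hn : n < r
    · have hk : n / R < r₀ := (hdiv_lt n).2 hn
      have ho : orig n = n / R := by simp only [horig]; rw [if_pos hk]
      rw [ho, hβ_of_lt n hn, hsucc n hn x hx]
      exact ⟨(hβp_mem _ hk x hx _).1, (hβp_mem _ hk x hx _).2⟩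
    · have hk : ¬ n / R < r₀ := by rw [hdiv_lt]; exact hn
      have ho : orig n = r₀ - 1 := by simp only [horig]; rw [if_neg hk]
      rw [ho, hβ_of_ge n (not_lt.1 hn), hβ_of_ge (n + 1) (by omega)]
      rcases Nat.eq_zero_or_pos r₀ with h0 | hpos
      · subst h0; exact ⟨le_rfl, hαm x hx (Nat.zero_le _)⟩
      · rw [Nat.sub_add_cancel hpos]
        exact ⟨hαm x hx (Nat.sub_le _ _), le_rfl⟩
  -- goodness of refined `𝒦₁`-pieces
  have hgood' : ∀ n, n < r → orig n ∈ K1 → ∀ x ∈ D, β n x < β (n + 1) x →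
      ∀ t ∈ Ioo (β n x) (β (n + 1) x), dCond g 2 (jw n) (Fin.snoc x t) := by
    intro n hn hK x hx hlt t ht
    have hk : n / R < r₀ := (hdiv_lt n).2 hn
    have ho : orig n = n / R := by simp only [horig]; rw [if_pos hk]
    rw [ho] at hK
    have hj : jw n = jwp (n / R) (n % R) := by simp only [hjw]; rw [if_pos ⟨hk, hK⟩]
    rw [hβ_of_lt n hn, hsucc n hn x hx] at hlt ht
    rw [hj]
    exact hgood (n / R) ⟨hK, hk⟩ (n % R) x hx hlt t ht
  refine ⟨r, β, orig, fun n => caseOfIdx (jw n), fun n => muOfIdx μ₀ (jw n), fun n => ?_, fun x hx => ?_,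
    fun x hx n hn => by rw [hβ_of_ge n hn], fun n hn => ?_, hcontain, ?_⟩
  · -- semialgebraic
    simp only [hβ]; split_ifs
    · exact hβs _ _
    · exact hαs r₀
  · -- `β 0 = α 0`
    rcases Nat.eq_zero_or_pos r₀ with h0 | hpos
    · rw [hβ_of_ge 0 (by rw [hr, h0, mul_zero]), h0]
    · rw [hβ_of_lt 0 (by rw [hr]; exact Nat.mul_pos hRpos hpos)]
      show βp (0 / R) (0 % R) x = α 0 x
      rw [Nat.zero_div, Nat.zero_mod, hβ0 0 x hx]
  · simp only [horig]; rw [if_pos ((hdiv_lt n).2 hn)]; exact (hdiv_lt n).2 hn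
  · -- the case data
    have hcont : ∀ n, ContinuousOn (β n) D := fun n => by
      simp only [hβ]; split_ifs
      · exact hβc _ _
      · exact hαc r₀
    have hmono : ∀ x ∈ D, Monotone fun n => β n x := fun x hx => by
      refine monotone_nat_of_le_succ fun n => ?_
      by_cases hn : n < r
      · rw [hβ_of_lt n hn, hsucc n hn x hx]
        exact hβm _ x hx (Nat.le_succ _)
      · rw [hβ_of_ge n (not_lt.1 hn), hβ_of_ge (n + 1) (by omega)]
    have hβ0' : ∀ x ∈ D, β 0 x = α 0 x := fun x hx => by
      rcases Nat.eq_zero_or_pos r₀ with h0 | hpos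
      · rw [hβ_of_ge 0 (by rw [hr, h0, mul_zero]), h0]
      · rw [hβ_of_lt 0 (by rw [hr]; exact Nat.mul_pos hRpos hpos)]
        show βp (0 / R) (0 % R) x = α 0 x
        rw [Nat.zero_div, Nat.zero_mod, hβ0 0 x hx]
    have htotal : lamTotal D β r = lamTotal D α r₀ := by
      ext p
      simp only [lamTotal, mem_setOf_eq]
      constructor
      · rintro ⟨hp, h1, h2⟩
        rw [hβ0' p.1 hp] at h1; rw [hβ_of_ge r le_rfl] at h2
        exact ⟨hp, h1, h2⟩
      · rintro ⟨hp, h1, h2⟩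
        rw [← hβ0' p.1 hp] at h1; rw [← hβ_of_ge r le_rfl] at h2
        exact ⟨hp, h1, h2⟩
    have hsubI : ∀ n, n < r → ∀ x ∈ D, Ioo (β n x) (β (n + 1) x) ⊆ Ioo (α (orig n) x) (α (orig n + 1) x) :=
      fun n _ x hx t ht => ⟨(hcontain n x hx).1.trans_lt ht.1, ht.2.trans_le (hcontain n x hx).2⟩
    have horig_lt : ∀ n, n < r → orig n < r₀ := fun n hn => by
      simp only [horig]; rw [if_pos ((hdiv_lt n).2 hn)]; exact (hdiv_lt n).2 hn
    have hcaseK : ∀ n, caseOfIdx (jw n) = true → n / R < r₀ ∧ orig n ∈ K1 := by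
      intro n hcase
      by_cases hcond : n / R < r₀ ∧ n / R ∈ K1
      · have ho : orig n = n / R := by simp only [horig]; rw [if_pos hcond.1]
        rw [ho]; exact hcond
      · have hj : jw n = 0 := by simp only [hjw]; rw [if_neg hcond]
        rw [hj, caseOfIdx_zero] at hcase
        exact absurd hcase Bool.false_ne_true
    exact
      { compact := hDc
        cont := hcont
        mono := hmono
        fcont := by rw [htotal]; exact hf
        one_le := by norm_num
        deriv := fun n hn _ x hx t ht ν =>
          hderiv (orig n) hn.2 (horig_lt n hn.1) x hx t (hsubI n hn.1 x hx ht) ν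
        gcont := fun n hn _ ν => (hg (orig n) hn.2 (horig_lt n hn.1) ν).mono fun p hp =>
          ⟨hp.1, (hcontain n p.1 hp.1).1.trans_lt hp.2.1, hp.2.2.trans_le (hcontain n p.1 hp.1).2⟩
        caseI_bound := fun n hn _ hcase x hx t ht ν => by
          have hlt : β n x < β (n + 1) x := ht.1.trans ht.2
          have h := hgood' n hn.1 hn.2 x hx hlt t ht
          rw [eq_zero_of_caseOfIdx hcase, dCond_zero] at h
          have h' := h ν
          rw [hatG_snoc] at h'
          exact h'.le
        caseII_mem := fun n hn hcase => ⟨hn, (hcaseK n hcase).2⟩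
        caseII_lower := fun n hn hcase x hx t ht => by
          have hlt : β n x < β (n + 1) x := ht.1.trans ht.2
          have h := hgood' n hn (hcaseK n hcase).2 x hx hlt t ht
          rw [eq_succ_of_caseOfIdx (μ₀ := μ₀) hcase, dCond_succ, hatG_snoc] at h
          rw [show (2 : ℝ)⁻¹ = 2⁻¹ from rfl]
          exact h.1.le
        caseII_dom := fun n hn hcase x hx t ht ν => by
          have hlt : β n x < β (n + 1) x := ht.1.trans ht.2
          have h := hgood' n hn (hcaseK n hcase).2 x hx hlt t ht
          rw [eq_succ_of_caseOfIdx (μ₀ := μ₀) hcase, dCond_succ, hatG_snoc] at h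
          have h' := h.2 ν
          rw [hatG_snoc] at h'
          exact h'.le }

end Dichotomy

end Literature.ModelTheory.ExponentialFields
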